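import Summits.QuantumAdvantage.QuantumAdvantage.Theses.CubicForrelation
import Summits.QuantumAdvantage.QuantumAdvantage.Theorems.NearExactIsExact.Negative.ProjectionConcat
import Summits.QuantumAdvantage.QuantumAdvantage.Theorems.CubicForrelationNearExactIsExactAxParity

/-!
# Crux `CubicForrelation.NearExactIsExact` (stmt-QuantumAdvantage-14043) — negative side (disprover gen 26):
  the XOR BOUND for projection concatenations and the CORNER-FLIP families

Setting of `…Negative.ProjectionConcat` (gen 13): `G = pcG h` is the `2^k`-fold concatenation of the slices
`h_a = h(·,a)`, `a ∈ 𝔽₂^k`, on `M = m + m` bits; if the slices are bent with duals `d_a` then the dual of `G` is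
`pcF d` and `Φ_max(G) = 1 − dist(Ψ, RM(3, M+k))/2^{M+k−1}` for the DUAL TABLE `Ψ(b', a) = d_a(b')`.

This file adds two uniform (all `M`, all `k ≥ 4`) facts about that distance.

* **XOR BOUND** (`xb_xor_bound`, `xb_forrelation_le_xor`).  For `k ≥ 4` every cubic `c'` on `M + k` bits has
  EVEN weight on each `a`-cube `{u} × 𝔽₂^k` (Ax / McEliece: `stub_axParity` with `⌈k/3⌉ ≥ 2`), so
  `dist(Ψ, RM(3, M+k)) ≥ #{u : ⊕_a Ψ(u,a) = 1}` — the weight of the XOR of ALL slice duals is a lower bound for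
  the defect, and `Φ(f, pcG h) ≤ 1 − 2·#{u : ⊕_a d_a(u) = 1}/2^{M+k}` for every cubic `f`.  (Apply it to the
  table re-blocked along any `4` of the `k` frame coordinates to bound by fourth `a`-differences.)  So a
  projection-concatenation family with `Φ → 1` must have slice duals whose XOR over the frame is SPARSE.
  (The same parity principle on affine `4`-flats drives the per-instance, `native_decide`d flat-packing
  certificates of `…Negative.FlatPacking`; here it is applied uniformly, with no computation, to the `a`-cubes of a
  projection concatenation, where the extremisers can be named.)
* **CORNER-FLIP VALUE** (`xb_forrelation_cornerFlip`).  The bound is attained by the tables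
  `Ψ = C ⊕ [a = 1…1]·e` with `C` jointly cubic: if the slices `h_a` are bent with duals `C_a` for `a ≠ 1…1` and
  `C_{1…1} ⊕ e` at the all-ones corner, then `Φ(pcF C, pcG h) = 1 − 2·wt(e)/2^{M+k}` exactly
  (`pc_forrelation_avg_of_exact` + `bb_forrelation_eq_of_dual`); this is `< 1` iff `e ≠ 0` and `≥ 1 − 2^{1−k}`.
  Hence (`xb_nearExactIsExact_false_of_cornerFlipFamilies`): IF for every `j` there is such a CORNER-FLIP
  FAMILY of order `k ≥ j` (with `h`, `C` jointly cubic, `e ≠ 0`), THEN `NearExactIsExact` is false — the pairs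
  `(pcF C, pcG h)` are cubic (`pcF_isDegLeFun`, `pcG_isDegLeFun`) on `2(m+k)` bits with `1 − 2^{1−k} ≤ Φ < 1`.
  Whether corner-flip families of unbounded order exist is OPEN; none is known for `k ≥ 6` (value `> 15/16`);
  by THEOREM BENT of the programme (DISPROOF.md §18) the first admissible one with `Φ > 15/16` lives on
  `N = 2(m+k) ≥ 22` bits.  (The hypothesis is inlined in the theorem; no new `Prop` is declared.)

HONEST FRAMING: a uniform NECESSARY condition (XOR bound) and a uniform SUFFICIENT configuration (corner flips)
for high Forrelation inside the projection-concatenation habitat, plus the implication "corner-flip families of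
unbounded order ⇒ ¬ NearExactIsExact".  No such family is exhibited; this is NOT summit progress and NOT a
refutation.  Proved from the tree (`stub_axParity`, `fc_sum_signOf_eq_card`, `acx_deg_slice`,
`card_filter_append`, `pc_forrelation_le`, `pc_forrelation_avg_of_exact`, `bb_forrelation_eq_of_dual`,
`pcF_isDegLeFun`, `pcG_isDegLeFun`); standard axioms. [this work]
-/

set_option linter.dupNamespace false -- D-0017: single-problem summit ⇒ `QuantumAdvantage.QuantumAdvantage` by design

noncomputable section

namespace Summit.QuantumAdvantage.QuantumAdvantage.Theorems.NearExactIsExact.Negative.XorBound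

open Finset
open Literature.Computability.QuantumComplexity
open Literature.Computability.QuantumComplexity.DerivativeWalsh (W)
open Summit.QuantumAdvantage.QuantumAdvantage.Theorems.CubicForrelation.NearExactIsExact
open Summit.QuantumAdvantage.QuantumAdvantage.Theorems.NearExactIsExact.Negative.ProjectionConcat

variable {M k : ℕ}

/-! ### Cubics have even weight on cubes of dimension `≥ 4` -/

/-- **Ax / McEliece on the full cube.** A Boolean function of algebraic degree `≤ 3` on `k ≥ 4` bits takes the
value `true` an even number of times (`Σ (−1)^h ∈ 2^{⌈k/3⌉}ℤ ⊆ 4ℤ`). [cite: Carlet2020, §4.1] -/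
theorem xb_even_card_of_cubic (hk : 4 ≤ k) {h : (Fin k → Bool) → Bool} (hh : IsDegLeFun 3 h) :
    Even ((univ.filter fun a : Fin k → Bool => h a = true).card) := by
  obtain ⟨z, hz⟩ := stub_axParity k 3 h univ (by norm_num) hh
  rw [filter_true_of_mem (fun u _ i _ => mem_univ i), card_fin, fc_sum_signOf_eq_card] at hz
  set w := (univ.filter fun a : Fin k → Bool => h a = true).card with hw
  have he2 : 2 ≤ (k + 3 - 1) / 3 := by omega
  obtain ⟨t, ht⟩ : ∃ t, (k + 3 - 1) / 3 = t + 2 := ⟨(k + 3 - 1) / 3 - 2, by omega⟩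
  obtain ⟨s, hs⟩ : ∃ s, k = s + 2 := ⟨k - 2, by omega⟩
  rw [ht] at hz
  have hk2 : (2 : ℝ) ^ k = 4 * (2 : ℝ) ^ s := by rw [hs, pow_add]; ring
  have ht2 : (2 : ℝ) ^ (t + 2) = 4 * (2 : ℝ) ^ t := by rw [pow_add]; ring
  rw [hk2, ht2] at hz
  -- `4·2^s − 2w = 4·2^t·z`, so `w = 2·(2^s − 2^t z)`.
  have hc : ((w : ℤ) : ℝ) = ((2 * (2 ^ s - 2 ^ t * z) : ℤ) : ℝ) := by
    push_cast
    linear_combination (-(1 : ℝ) / 2) * hz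
  have hwz : (w : ℤ) = 2 * (2 ^ s - 2 ^ t * z) := Int.cast_injective hc
  have hev : Even (w : ℤ) := ⟨2 ^ s - 2 ^ t * z, by rw [hwz]; ring⟩
  exact (Int.even_coe_nat _).mp hev

/-! ### The XOR of a table over the frame `𝔽₂^k` -/

/-- `⊕_{a ∈ 𝔽₂^k} Ψ(u, a)`: the XOR of all slices of the table `Ψ` at the point `u`. -/
def cubeXor (Ψ : (Fin M → Bool) → (Fin k → Bool) → Bool) (u : Fin M → Bool) : Bool :=
  decide (Odd ((univ.filter fun a : Fin k → Bool => Ψ u a = true).card))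

/-- A cubic `c'` on `M + k` bits (`k ≥ 4`) differs from `Ψ` somewhere on every `a`-cube where `⊕_a Ψ(u,a) = 1`. -/
theorem xb_one_le_card_slice (hk : 4 ≤ k) (Ψ : (Fin M → Bool) → (Fin k → Bool) → Bool)
    (c' : (Fin (M + k) → Bool) → Bool) (hc' : IsDegLeFun 3 c') (u : Fin M → Bool) (hu : cubeXor Ψ u = true) :
    1 ≤ (univ.filter fun a : Fin k → Bool => c' (Fin.append u a) ≠ Ψ u a).card := by
  rw [Nat.one_le_iff_ne_zero, Ne, card_eq_zero, filter_eq_empty_iff]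
  intro hall
  have heq : (univ.filter fun a : Fin k → Bool => c' (Fin.append u a) = true) =
      univ.filter fun a : Fin k → Bool => Ψ u a = true :=
    filter_congr fun a _ => by
      have e : c' (Fin.append u a) = Ψ u a := by simpa using hall (mem_univ a)
      rw [e]
  have hev := xb_even_card_of_cubic hk (acx_deg_slice hc' u)
  rw [heq] at hev
  unfold cubeXor at hu
  rw [decide_eq_true_eq] at hu
  exact (Nat.not_even_iff_odd.mpr hu) hev

/-- **XOR BOUND.** For `k ≥ 4`, every cubic `c'` on `M + k` bits is at Hamming distance at least
`#{u : ⊕_a Ψ(u,a) = 1}` from the table `Ψ` (read as a function of `v = (u ‖ a)`). -/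
theorem xb_xor_bound (hk : 4 ≤ k) (Ψ : (Fin M → Bool) → (Fin k → Bool) → Bool)
    (c' : (Fin (M + k) → Bool) → Bool) (hc' : IsDegLeFun 3 c') :
    (univ.filter fun u => cubeXor Ψ u = true).card ≤
      (univ.filter fun v : Fin (M + k) → Bool =>
        c' v ≠ Ψ (fun i => v (Fin.castAdd k i)) (fun j => v (Fin.natAdd M j))).card := by
  rw [card_filter_append (n₁ := M) (n₂ := k)]
  simp only [Fin.append_left, Fin.append_right]
  rw [card_eq_sum_ones, sum_filter]
  refine sum_le_sum fun u _ => ?_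
  by_cases hu : cubeXor Ψ u = true
  · rw [if_pos hu]
    exact xb_one_le_card_slice hk Ψ c' hc' u hu
  · rw [if_neg hu]
    exact Nat.zero_le _

/-- **XOR BOUND for Forrelation.** If the slices `h_a` are bent on `m + m` bits with duals `d_a` (`k ≥ 4`), then
every cubic `f` has `Φ(f, pcG h) ≤ 1 − 2·2^k·X/2^{k+(m+m+k)} = 1 − 2X/2^{m+m+k}`, `X = #{u : ⊕_a d_a(u) = 1}`. -/
theorem xb_forrelation_le_xor {m k : ℕ} (hk : 4 ≤ k) (h d : (Fin (m + m) → Bool) → (Fin k → Bool) → Bool)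
    (hd : ∀ a u, W (fun y => signOf (h y a)) u = (2 : ℝ) ^ m * signOf (d u a))
    (f : (Fin (k + (m + m + k)) → Bool) → Bool) (hf : IsDegLeFun 3 f) :
    forrelation f (pcG h) ≤
      1 - 2 * ((2 : ℝ) ^ k * ((univ.filter fun u => cubeXor d u = true).card : ℕ)) / 2 ^ (k + (m + m + k)) :=
  pc_forrelation_le h d hd _ (fun c' hc' => xb_xor_bound hk d c' hc') f hf

/-! ### Corner-flip tables attain the bound -/

/-- **Attainment on structured partners.** For ANY table `C` (bent slices `h_a` with duals `d_a`):
`Φ(pcF C, pcG h) = 1 − 2·d(C, Ψ)/2^{m+m+k}` with `d(C, Ψ) = #{(u,a) : C(u,a) ≠ d_a(u)}` (read on `v = (u ‖ a)`).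
So over the partners `f = pcF C`, `C` jointly cubic, the value is exactly `1 −` (twice the distance of the dual
table to the jointly cubic tables)`/2^{m+m+k}` — the equality case of `pc_forrelation_le`. -/
theorem xb_forrelation_pcF {m k : ℕ} (h d C : (Fin (m + m) → Bool) → (Fin k → Bool) → Bool)
    (hd : ∀ a u, W (fun y => signOf (h y a)) u = (2 : ℝ) ^ m * signOf (d u a)) :
    forrelation (pcF C) (pcG h) =
      1 - 2 * ((univ.filter fun v : Fin (m + m + k) → Bool =>
        C (fun i => v (Fin.castAdd k i)) (fun j => v (Fin.natAdd (m + m) j)) ≠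
          d (fun i => v (Fin.castAdd k i)) (fun j => v (Fin.natAdd (m + m) j))).card : ℝ) / 2 ^ (m + m + k) := by
  rw [pc_forrelation_eq h d hd (pcF C)]
  have hc : (univ.filter fun z : Fin (k + (m + m + k)) → Bool => pcF C z ≠ pcF d z).card =
      2 ^ k * (univ.filter fun v : Fin (m + m + k) → Bool =>
        C (fun i => v (Fin.castAdd k i)) (fun j => v (Fin.natAdd (m + m) j)) ≠
          d (fun i => v (Fin.castAdd k i)) (fun j => v (Fin.natAdd (m + m) j))).card := by
    rw [card_filter_append (n₁ := k) (n₂ := m + m + k)]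
    have key : ∀ c : Fin k → Bool,
        (univ.filter fun v : Fin (m + m + k) → Bool => pcF C (Fin.append c v) ≠ pcF d (Fin.append c v)).card =
          (univ.filter fun v : Fin (m + m + k) → Bool =>
            C (fun i => v (Fin.castAdd k i)) (fun j => v (Fin.natAdd (m + m) j)) ≠
              d (fun i => v (Fin.castAdd k i)) (fun j => v (Fin.natAdd (m + m) j))).card := by
      intro c
      refine congrArg card (filter_congr fun v _ => ?_)
      simp only [pcF, fst_append, mid_append, lst_append]
      cases C (fun i => v (Fin.castAdd k i)) (fun j => v (Fin.natAdd (m + m) j)) <;>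
        cases d (fun i => v (Fin.castAdd k i)) (fun j => v (Fin.natAdd (m + m) j)) <;>
          cases ipb (fun j => v (Fin.natAdd (m + m) j)) c <;> decide
    simp_rw [key]
    rw [sum_const, card_univ, Fintype.card_fun, Fintype.card_bool, Fintype.card_fin, smul_eq_mul]
  rw [hc, pow_add (2 : ℝ) k (m + m + k)]
  push_cast
  have h1 : (0 : ℝ) < (2 : ℝ) ^ k := by positivity
  have h2 : (0 : ℝ) < (2 : ℝ) ^ (m + m + k) := by positivity
  field_simp

/-- `[a = 1…1]`. -/
def allOnes (a : Fin k → Bool) : Bool := decide (∀ j, a j = true)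

/-- The all-ones corner of the frame. -/
def ones : Fin k → Bool := fun _ => true

/-- `[a = 1…1] = true ↔ a = 1…1`. -/
theorem allOnes_eq_true_iff (a : Fin k → Bool) : allOnes a = true ↔ a = ones := by
  unfold allOnes ones
  rw [decide_eq_true_eq]
  exact ⟨fun h => funext h, fun h j => by rw [h]⟩

/-- The corner-flip table `Ψ(u,a) = C(u,a) ⊕ [a = 1…1]·e(u)`. -/
def cornerFlip (C : (Fin M → Bool) → (Fin k → Bool) → Bool) (e : (Fin M → Bool) → Bool)
    (u : Fin M → Bool) (a : Fin k → Bool) : Bool :=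
  xor (C u a) (allOnes a && e u)

/-- Off the corner the table is `C`. -/
theorem cornerFlip_of_ne {C : (Fin M → Bool) → (Fin k → Bool) → Bool} {e : (Fin M → Bool) → Bool}
    {a : Fin k → Bool} (ha : a ≠ ones) (u : Fin M → Bool) : cornerFlip C e u a = C u a := by
  have h0 : allOnes a = false := by
    rw [← Bool.not_eq_true, allOnes_eq_true_iff]; exact ha
  simp [cornerFlip, h0]

/-- At the corner the table is `C ⊕ e`. -/
theorem cornerFlip_ones (C : (Fin M → Bool) → (Fin k → Bool) → Bool) (e : (Fin M → Bool) → Bool)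
    (u : Fin M → Bool) : cornerFlip C e u ones = xor (C u ones) (e u) := by
  have h1 : allOnes (ones : Fin k → Bool) = true := (allOnes_eq_true_iff _).mpr rfl
  simp [cornerFlip, h1]

/-- **CORNER-FLIP VALUE.** If the slices `h_a` (`a ∈ 𝔽₂^k`) are bent on `m + m` bits with duals
`C_a ⊕ [a = 1…1]·e`, then `Φ(pcF C, pcG h) = 1 − 2·wt(e)/2^{m+m+k}`: all slices but the corner are exact pairs
`(C_a, h_a)`, the corner pair has `Φ = 1 − 2·wt(e)/2^{m+m}`, and `pc_forrelation_avg_of_exact` divides the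
defect by `2^k`. -/
theorem xb_forrelation_cornerFlip {m k : ℕ} (h C : (Fin (m + m) → Bool) → (Fin k → Bool) → Bool)
    (e : (Fin (m + m) → Bool) → Bool)
    (hd : ∀ a u, W (fun y => signOf (h y a)) u = (2 : ℝ) ^ m * signOf (cornerFlip C e u a)) :
    forrelation (pcF C) (pcG h) =
      1 - 2 * ((univ.filter fun u => e u = true).card : ℝ) / 2 ^ (m + m + k) := by
  have hex : ∀ a, a ≠ (ones : Fin k → Bool) → forrelation (fun u => C u a) (fun y => h y a) = 1 := by
    intro a ha
    rw [bb_forrelation_eq_of_dual (fun u => C u a) (fun y => h y a) (fun u => C u a)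
      (fun u => by rw [hd a u, cornerFlip_of_ne ha])]
    have h0 : (univ.filter fun u : Fin (m + m) → Bool => C u a ≠ C u a).card = 0 := by simp
    rw [h0]; simp
  rw [pc_forrelation_avg_of_exact C h ones hex,
    bb_forrelation_eq_of_dual (fun u => C u ones) (fun y => h y ones) (fun u => xor (C u ones) (e u))
      (fun u => by rw [hd ones u, cornerFlip_ones])]
  have hc : (univ.filter fun u : Fin (m + m) → Bool => C u ones ≠ xor (C u ones) (e u)).card =
      (univ.filter fun u : Fin (m + m) → Bool => e u = true).card := by
    refine congrArg card (filter_congr fun u _ => ?_)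
    cases C u ones <;> cases e u <;> decide
  rw [hc, pow_add (2 : ℝ) (m + m) k]
  have h1 : (0 : ℝ) < (2 : ℝ) ^ (m + m) := by positivity
  have h2 : (0 : ℝ) < (2 : ℝ) ^ k := by positivity
  field_simp
  ring

/-- The corner-flip value is `≥ 1 − 2/2^k` (since `wt(e) ≤ 2^{m+m}`). -/
theorem xb_forrelation_cornerFlip_ge {m k : ℕ} (h C : (Fin (m + m) → Bool) → (Fin k → Bool) → Bool)
    (e : (Fin (m + m) → Bool) → Bool)
    (hd : ∀ a u, W (fun y => signOf (h y a)) u = (2 : ℝ) ^ m * signOf (cornerFlip C e u a)) :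
    1 - 2 / (2 : ℝ) ^ k ≤ forrelation (pcF C) (pcG h) := by
  rw [xb_forrelation_cornerFlip h C e hd]
  have h1 : (0 : ℝ) < (2 : ℝ) ^ (m + m) := by positivity
  have h2 : (0 : ℝ) < (2 : ℝ) ^ k := by positivity
  have hw : ((univ.filter fun u : Fin (m + m) → Bool => e u = true).card : ℝ) ≤ (2 : ℝ) ^ (m + m) := by
    have := card_le_univ (univ.filter fun u : Fin (m + m) → Bool => e u = true)
    rw [Fintype.card_fun, Fintype.card_bool, Fintype.card_fin] at this
    exact_mod_cast this
  have hratio : ((univ.filter fun u : Fin (m + m) → Bool => e u = true).card : ℝ) / (2 : ℝ) ^ (m + m) ≤ 1 := by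
    rwa [div_le_one h1]
  have e1 : 2 * ((univ.filter fun u : Fin (m + m) → Bool => e u = true).card : ℝ) / (2 : ℝ) ^ (m + m + k) =
      2 / (2 : ℝ) ^ k * (((univ.filter fun u : Fin (m + m) → Bool => e u = true).card : ℝ) / (2 : ℝ) ^ (m + m)) := by
    rw [pow_add]
    field_simp
  rw [e1]
  have h3 : (0 : ℝ) ≤ 2 / (2 : ℝ) ^ k := by positivity
  nlinarith [mul_le_mul_of_nonneg_left hratio h3]

/-- The corner-flip value is `< 1` as soon as `e ≠ 0`. -/
theorem xb_forrelation_cornerFlip_lt_one {m k : ℕ} (h C : (Fin (m + m) → Bool) → (Fin k → Bool) → Bool)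
    (e : (Fin (m + m) → Bool) → Bool) (he : ∃ u, e u = true)
    (hd : ∀ a u, W (fun y => signOf (h y a)) u = (2 : ℝ) ^ m * signOf (cornerFlip C e u a)) :
    forrelation (pcF C) (pcG h) < 1 := by
  rw [xb_forrelation_cornerFlip h C e hd]
  obtain ⟨u, hu⟩ := he
  have hpos : (1 : ℝ) ≤ ((univ.filter fun u : Fin (m + m) → Bool => e u = true).card : ℝ) := by
    have : 1 ≤ (univ.filter fun u : Fin (m + m) → Bool => e u = true).card :=
      card_pos.mpr ⟨u, mem_filter.mpr ⟨mem_univ u, hu⟩⟩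
    exact_mod_cast this
  have h1 : (0 : ℝ) < (2 : ℝ) ^ (m + m + k) := by positivity
  have : 0 < 2 * (((univ.filter fun u : Fin (m + m) → Bool => e u = true).card : ℝ)) / (2 : ℝ) ^ (m + m + k) := by
    positivity
  linarith

/-! ### Corner-flip families of unbounded order would refute the crux -/

/-- `2/2^k → 0`: for `θ < 1` some `k₀` has `θ < 1 − 2/2^k` for all `k ≥ k₀`. -/
theorem xb_exists_order (θ : ℝ) (hθ : θ < 1) : ∃ k₀ : ℕ, ∀ k, k₀ ≤ k → θ < 1 - 2 / (2 : ℝ) ^ k := by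
  obtain ⟨k₀, hk₀⟩ := pow_unbounded_of_one_lt (2 / (1 - θ)) (by norm_num : (1 : ℝ) < 2)
  refine ⟨k₀, fun k hk => ?_⟩
  have h1 : (0 : ℝ) < 1 - θ := by linarith
  have h2 : (2 : ℝ) ^ k₀ ≤ (2 : ℝ) ^ k := pow_le_pow_right₀ (by norm_num) hk
  have h3 : 2 / (1 - θ) < (2 : ℝ) ^ k := lt_of_lt_of_le hk₀ h2
  have h4 : (0 : ℝ) < (2 : ℝ) ^ k := by positivity
  rw [div_lt_iff₀ h1] at h3
  have h5 : 2 / (2 : ℝ) ^ k < 1 - θ := by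
    rw [div_lt_iff₀ h4]; linarith
  linarith

/-- **Corner-flip families of unbounded order refute `NearExactIsExact`.**  HYPOTHESIS (OPEN — no example with
`k ≥ 6` is known; the programme's censuses, DISPROOF.md §§20–21, found none over `8`- and `10`-bit Maiorana–McFarland
centres): for every `j` there are `k ≥ j`, a jointly cubic slice table `h` on `(m+m) + k` bits and a jointly cubic
table `C` such that every slice `h_a` is bent with dual `C_a` for `a ≠ 1…1` and `C_{1…1} ⊕ e` at the all-ones
corner, `e ≠ 0`.  CONCLUSION: `pcF C`, `pcG h` are cubic on the even number `k + (m+m+k) = 2(m+k)` of bits with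
`1 − 2/2^k ≤ Φ(pcF C, pcG h) < 1`, contradicting any threshold `θ < 1`.  An implication, not a refutation. [this work] -/
theorem xb_nearExactIsExact_false_of_cornerFlipFamilies
    (H : ∀ j : ℕ, ∃ m k : ℕ, j ≤ k ∧
      ∃ (h C : (Fin (m + m) → Bool) → (Fin k → Bool) → Bool) (e : (Fin (m + m) → Bool) → Bool),
        IsDegLeFun 3 (fun v : Fin (m + m + k) → Bool =>
          h (fun i => v (Fin.castAdd k i)) (fun j => v (Fin.natAdd (m + m) j))) ∧
        IsDegLeFun 3 (fun v : Fin (m + m + k) → Bool =>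
          C (fun i => v (Fin.castAdd k i)) (fun j => v (Fin.natAdd (m + m) j))) ∧
        (∃ u, e u = true) ∧
        ∀ a u, W (fun y => signOf (h y a)) u = (2 : ℝ) ^ m * signOf (cornerFlip C e u a)) :
    ¬ Summit.QuantumAdvantage.QuantumAdvantage.Theses.CubicForrelation.NearExactIsExact := by
  rintro ⟨θ, hθ, hiso⟩
  obtain ⟨k₀, hk₀⟩ := xb_exists_order θ hθ
  obtain ⟨m, k, hjk, h, C, e, hh, hC, he, hd⟩ := H k₀
  have hn : Even (k + (m + m + k)) := ⟨m + k, by ring⟩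
  have hF : IsDegLeFun 3 (pcF C) := pcF_isDegLeFun C hC
  have hG : IsDegLeFun 3 (pcG h) := pcG_isDegLeFun h hh
  have hge := xb_forrelation_cornerFlip_ge h C e hd
  have hlt := xb_forrelation_cornerFlip_lt_one h C e he hd
  have hθΦ : θ < forrelation (pcF C) (pcG h) := lt_of_lt_of_le (hk₀ k hjk) hge
  have h1 := hiso (k + (m + m + k)) hn (pcF C) (pcG h) hF hG hθΦ
  linarith

end Summit.QuantumAdvantage.QuantumAdvantage.Theorems.NearExactIsExact.Negative.XorBound

end
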